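import Literature.NumberTheory.ModularSymbols.CuspidalHomologyNormDegeneracy
import Literature.NumberTheory.EllipticCurves.NewformsOldHeckeStableProofs
import Literature.LinearAlgebra.CommutingFamilyFittingProjection
import Mathlib.GroupTheory.FiniteAbelian.Basic
import HarnessLib

/-!
# Mod-`3` Hecke eigensystems of the norm image `Nm Λ_N` come from level `N/3`
# (`9 ∣ N`; sequel to `CuspidalHomologyNormDegeneracy`: Hecke equivariance of `π_*`, `π^*` at ALL primes `q ≠ 3`,
# `ker π_* = Λ_P`, `3Λ_{N/3} ⊆ π_*Λ_N`, and the transport of "no `ā`-generalised eigenvector mod `3`")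

Topic `Literature/NumberTheory/ModularSymbols`, namespace `Literature.NumberTheory.ModularSymbols`. Typing/proving
for the BSD ideation cell `bsd-idea-3` (route `TameQuarticManinParity`, LINE 29, item H1 =
`stmt-BirchSwinnertonDyer-23479` `TprimeIrrNormImageAvoidsThree`). The sibling `CuspidalHomologyNormDegeneracy`
(typer `bsd-line-tqmp-ty1`) identifies the tree's norm `Nm = 1 + t + t²` on `Λ_N = H₁(X₀(N), ℤ)`
(`normInt N h9`, `CuspidalHomologyShiftNorm`) with `π^* π_*` for the cyclic triple cover `X₀(N) → X₀(N/3)`: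
`π_* = pushforwardInt N h3 : Λ_N → Λ_{N/3}` (`= ι₃^∨`), `π^* = transferInt N h9 : Λ_{N/3} → Λ_N` (`= U₃^∨`),
`transferInt ∘ pushforwardInt = normInt`, `pushforwardInt ∘ transferInt = 3`, `transferInt` injective, and Hecke
equivariance for primes `p ∤ N`. This file adds what the H1 assembly («eigensystem of `L′/3L′`, `L′ = π_*Λ_N`,
`3Λ_{N/3} ⊆ L′ ⊆ Λ_{N/3}` → eigensystem of `Λ_{N/3}/3Λ_{N/3}`», typer report 2026-08-28 (E)) still needs:

* **Hecke equivariance at every prime `q ≠ 3`, including `q ∣ N/3` (`U_q`)**: on cusp forms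
  `T_q ∘ degeneracyMap0 = degeneracyMap0 ∘ T_q` for `q ∤ d` (`heckeT_degeneracyMap0_of_not_dvd`, from the tree's
  `heckeT_iota_of_not_dvd`) and `T_q ∘ adjDegeneracyMap0 = adjDegeneracyMap0 ∘ T_q` across the levels `N`, `N/p`
  for `p² ∣ N`, `q ≠ p` (`heckeT_adjDegeneracyMap0_of_sq_dvd`, by `q`-expansions: `a_n(U_p f) = a_{pn}(f)`,
  Diamond–Shurman Prop. 5.2.2(a)); on `Λ`: `pushforwardInt_smul_T_of_ne_three`, `transferInt_smul_T_of_ne_three`.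
* **`ker π_* = Λ_P = prymLattice`** (`ker_pushforwardInt_eq_prymLattice`; `Nm = π^*π_*`, `π^*` injective),
  `π_* x = π_* x' ↔ Nm x = Nm x'`, and **`3 Λ_{N/3} ⊆ π_* Λ_N`** (`three_smul_mem_range_pushforwardInt`).
* **The transport theorem** `exists_normInt_eq_three_smul_of_level_div_three` (the shape of item H1): for a finite
  set `S` of primes, integers `a_p`, and `9 ∣ N`: IF every `y ∈ Λ_{N/3}` with `(T_p − a_p)^{k_p} y ∈ 3Λ_{N/3}`
  for all `p ∈ S`, `p ≠ 3`, lies in `3Λ_{N/3}` («`ā` is not a generalised mod-`3` Hecke eigensystem of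
  `H₁(X₀(N/3), ℤ)/3`»), THEN every `z ∈ Λ_N` with `Nm((T_p − a_p)^{k_p} z) ∈ 3Λ_N` for all such `p` has
  `Nm z ∈ 3Λ_N`. Proof: with `K = Nm⁻¹(3Λ_N) ⊆ Λ_N` and `L″ = π_*(K) ⊆ Λ_{N/3}` one has `3Λ_{N/3} ⊆ L″`
  (`3y = π_*(π^*y)`, `Nm(π^*y) = 3π^*y`), `L″` is `T_p`-stable (`p ≠ 3`), the hypothesis says the joint
  `ā`-generalised eigenspace of the finite Hecke module `Λ_{N/3}/3Λ_{N/3}` is `0`, hence so is that of its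
  quotient `Λ_{N/3}/L″` (exactness of generalised eigenspaces on finite-length modules, the tree's Fitting
  corollary `CommutingFamily.mem_of_forall_pow_sub_smul_apply_mem`); `π_* z` is such a generalised eigenvector
  mod `L″` (equivariance), so `π_* z ∈ L″ = π_*(K)`, i.e. `π_* z = π_* v` with `Nm v ∈ 3Λ_N`, and
  `Nm z = π^*π_* z = π^*π_* v = Nm v ∈ 3Λ_N`. This is the «Brauer–Nesbitt for the isogenous lattices
  `3Λ_{N/3} ⊆ π_*Λ_N ⊆ Λ_{N/3}`» step (Serre, *Linear Representations*, §15.2) in the support form needed here.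

THEOREMS ONLY (no definition, no named fact, no instance); nothing about Galois representations, Serre weights or any
elliptic curve is asserted; no summit statement is touched. Statements at level `N/3` carry `[NeZero (N / 3)]`
(supply `haveI : NeZero (N / 3) := ⟨(Nat.div_pos (Nat.le_of_dvd (NeZero.pos N) h3) three_pos).ne'⟩`).

## References

* F. Diamond, J. Shurman, *A First Course in Modular Forms*, GTM 228 (2005), Prop. 5.2.2(a) (`q`-expansions of
  `T_p`, `U_p`), §5.7 (`ι_d`), Prop. 5.6.2 (Hecke operators vs. degeneracy maps), §6.2 (6.8) (`h_* ∘ h^* = deg h`).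
  [DiamondShurman2005]
* A. W. Knapp, *Elliptic Curves* (1992), Lemma 9.26 (`p² ∣ N ⇒ T(p) S_k(Γ₀(N)) ⊆ S_k(Γ₀(N/p))`). [Knapp1992]
* H. Lange, R. E. Rodríguez, *Decomposition of Jacobians by Prym Varieties*, LNM 2310 (2022), §3.2.1, Prop. 3.5.1
  (`Nm_G = f^* ∘ Nm_f`, `Nm_f ∘ f^* = d`; `ker Nm_f` = the Prym part). [LangeRodriguez2022]
* N. Jacobson, *Basic Algebra II* (1989), §3.4 Fitting's lemma (38) (through the tree's
  `CommutingFamilyFittingProjection`). [Jacobson1989BasicAlgebraII]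
* J.-P. Serre, *Linear Representations of Finite Groups*, §15.2 (reductions of stable lattices in one representation
  have the same composition factors — the lattice principle behind the transport theorem).
-/

noncomputable section

open scoped MatrixGroups ModularForm

open CongruenceSubgroup
open UpperHalfPlane hiding I
open Literature.NumberTheory.EllipticCurves.ModularForms

namespace Literature.NumberTheory.ModularSymbols

/-! ### §1. Hecke operators across the levels at every prime `q ≠ p` (cusp forms) -/

section CuspForms

variable {N : ℕ} [NeZero N] {k : ℤ}

omit [NeZero N] in
/-- `p · p ∣ N` from `p² ∣ N` (the spelling of the tree's `coe_adjDegeneracyMap0_of_sq_dvd`; private plumbing). [folklore] -/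
private theorem mul_self_dvd_of_sq_dvd {p : ℕ} (hp2 : p ^ 2 ∣ N) : p * p ∣ N := by
  simpa only [pow_two] using hp2

/-- **`T_q` commutes with the degeneracy map `B_d = [Γ₀(N/d) diag(d,1) Γ₀(N)]_k` across the levels** for primes
`q ∤ d` (`d ∣ N`): `T_q (degeneracyMap0 (N/d) N d k g) = degeneracyMap0 (N/d) N d k (T_q g)` — `T_q` at level
`N` on the left, at level `N/d` on the right; for `q ∣ N/d` both are `U_q` (the tree's `heckeT_degeneracyMap0`
covers `q ∤ N` only; this is its extension through `heckeT_iota_of_not_dvd`, Diamond–Shurman Prop. 5.6.2, first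
diagram). [cite: DiamondShurman2005, Prop. 5.6.2 (proof, first diagram)] -/
theorem heckeT_degeneracyMap0_of_not_dvd {d : ℕ} [NeZero d] [NeZero (N / d)] (hd : d ∣ N) {q : ℕ} [NeZero q]
    (hq : q.Prime) (hqd : ¬ q ∣ d) (g : CuspForm (Gamma0 (N / d)) k) :
    heckeT (Gamma0 N) k q (degeneracyMap0 (N / d) N d k g) =
      degeneracyMap0 (N / d) N d k (heckeT (Gamma0 (N / d)) k q g) := by
  have hdiv : N / d * d ∣ N := dvd_of_eq (Nat.div_mul_cancel hd)
  have hcop : Nat.Coprime q d := (Nat.Prime.coprime_iff_not_dvd hq).mpr hqd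
  have hMN : q ∣ N / d ↔ q ∣ N :=
    ⟨fun h ↦ h.trans (Nat.div_dvd_of_dvd hd), fun h ↦
      hcop.dvd_of_dvd_mul_right (by rwa [Nat.div_mul_cancel hd])⟩
  rw [degeneracyMap0_eq_smul_iota (N / d) N d k hdiv, degeneracyMap0_eq_smul_iota (N / d) N d k hdiv, map_smul,
    heckeT_iota_of_not_dvd hdiv hq hqd hMN]

variable {p : ℕ} [NeZero p] [NeZero (N / p)]

/-- `q`-expansion of the level-lowering `U_p = adjDegeneracyMap0 N (N/p) p k` for `p² ∣ N`: `a_n(U_p f) = a_{pn}(f)`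
(Knapp Lemma 9.26 via the tree's `coe_adjDegeneracyMap0_of_sq_dvd` and Diamond–Shurman Prop. 5.2.2(a),
`qExpansion_coeff_heckeT_holds`). [cite: Knapp1992, Lemma 9.26] -/
theorem qExpansion_coeff_adjDegeneracyMap0_of_sq_dvd (hp : p.Prime) (hp2 : p ^ 2 ∣ N)
    (f : CuspForm (Gamma0 N) k) (n : ℕ) :
    (qExpansion 1 ⇑(adjDegeneracyMap0 N (N / p) p k f)).coeff n = (qExpansion 1 ⇑f).coeff (p * n) := by
  have hpN : p ∣ N := dvd_trans (dvd_pow_self p two_ne_zero) hp2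
  rw [coe_adjDegeneracyMap0_of_sq_dvd hp (mul_self_dvd_of_sq_dvd hp2) f, qExpansion_coeff_heckeT_holds N k f p hp n,
    if_pos hpN, add_zero]

/-- `a_n(U_p f) = a_{pn}(f)` for the level-lowering `U_p`, `p² ∣ N`, in the `cuspCoeff` spelling. [cite: Knapp1992, Lemma 9.26] -/
theorem cuspCoeff_adjDegeneracyMap0_of_sq_dvd (hp : p.Prime) (hp2 : p ^ 2 ∣ N) (f : CuspForm (Gamma0 N) k)
    (n : ℕ) : cuspCoeff (adjDegeneracyMap0 N (N / p) p k f) n = cuspCoeff f (p * n) :=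
  qExpansion_coeff_adjDegeneracyMap0_of_sq_dvd hp hp2 f n

/-- **`T_q` commutes with the level-lowering `U_p` across the levels** for primes `q ≠ p`, `p² ∣ N`:
`T_q (adjDegeneracyMap0 N (N/p) p k f) = adjDegeneracyMap0 N (N/p) p k (T_q f)` — `T_q` at level `N/p` on the left,
at level `N` on the right; for `q ∣ N/p` both are `U_q` (the tree's `adjDegeneracyMap0_heckeT` covers `q ∤ N` only).
On `q`-expansions both sides have `a_n = a_{pqn}(f) + 𝟙_{q∤N} q^{k-1} 𝟙_{q∣n} a_{pn/q}(f)`.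
[cite: DiamondShurman2005, Prop. 5.2.2(a) (q-expansions of T_q, U_q; derived reading, coefficientwise)] -/
theorem heckeT_adjDegeneracyMap0_of_sq_dvd (hp : p.Prime) (hp2 : p ^ 2 ∣ N) {q : ℕ} [NeZero q] (hq : q.Prime)
    (hqp : q ≠ p) (f : CuspForm (Gamma0 N) k) :
    heckeT (Gamma0 (N / p)) k q (adjDegeneracyMap0 N (N / p) p k f) =
      adjDegeneracyMap0 N (N / p) p k (heckeT (Gamma0 N) k q f) := by
  have hpN : p ∣ N := dvd_trans (dvd_pow_self p two_ne_zero) hp2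
  have hqp' : ¬ q ∣ p := fun h ↦ hqp ((Nat.prime_dvd_prime_iff_eq hq hp).mp h)
  have hdvdN : q ∣ N / p ↔ q ∣ N := by
    refine ⟨fun h ↦ h.trans (Nat.div_dvd_of_dvd hpN), fun h ↦ ?_⟩
    rw [← Nat.div_mul_cancel hpN] at h
    exact ((Nat.Prime.dvd_mul hq).mp h).resolve_right hqp'
  have hdvdn : ∀ m : ℕ, q ∣ p * m ↔ q ∣ m := fun m ↦
    ⟨fun h ↦ ((Nat.Prime.dvd_mul hq).mp h).resolve_left hqp', fun h ↦ dvd_mul_of_dvd_right h p⟩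
  refine eq_of_forall_cuspCoeff_eq_gamma0 fun n ↦ ?_
  rw [cuspCoeff_adjDegeneracyMap0_of_sq_dvd hp hp2]
  simp only [cuspCoeff]
  rw [qExpansion_coeff_heckeT_holds (N / p) k _ q hq n, qExpansion_coeff_heckeT_holds N k f q hq (p * n)]
  simp only [qExpansion_coeff_adjDegeneracyMap0_of_sq_dvd hp hp2]
  rw [mul_left_comm q p n]
  by_cases hqN : q ∣ N
  · rw [if_pos hqN, if_pos (hdvdN.mpr hqN)]
  · rw [if_neg hqN, if_neg (fun h ↦ hqN (hdvdN.mp h))]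
    by_cases hqn : q ∣ n
    · rw [if_pos hqn, if_pos ((hdvdn n).mpr hqn), Nat.mul_div_assoc p hqn]
    · rw [if_neg hqn, if_neg (fun h ↦ hqn ((hdvdn n).mp h))]

end CuspForms

/-! ### §2. On `Λ`: equivariance of `π_*`, `π^*` at all primes `q ≠ 3`; `ker π_* = Λ_P`; `3Λ_{N/3} ⊆ π_* Λ_N` -/

section Lattice

variable (N : ℕ) [NeZero N] [NeZero (N / 3)] (h9 : 3 ^ 2 ∣ N) (h3 : 3 ∣ N)

/-- **`π_* T_q = T_q π_*` on `Λ` for every prime `q ≠ 3`** (`U_q` for `q ∣ N/3` included): transpose of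
`heckeT_degeneracyMap0_of_not_dvd` (the sibling's `pushforwardInt_smul_T` is the case `q ∤ N`).
[cite: DiamondShurman2005, Prop. 5.6.2 (proof, first diagram)] -/
theorem pushforwardInt_smul_T_of_ne_three {q : ℕ} (hq : q.Prime) (hq3 : q ≠ 3) (x : periodHomologyHecke N) :
    pushforwardInt N h3 (HeckeRing0.T N 2 q hq • x) = HeckeRing0.T (N / 3) 2 q hq • pushforwardInt N h3 x := by
  haveI : NeZero q := ⟨hq.ne_zero⟩
  have hq3' : ¬ q ∣ 3 := fun h ↦ hq3 ((Nat.prime_dvd_prime_iff_eq hq Nat.prime_three).mp h)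
  apply Subtype.ext
  refine LinearMap.ext fun g ↦ ?_
  rw [coe_pushforwardInt, LinearMap.dualMap_apply, coe_smul_apply, coe_smul_apply, coe_pushforwardInt,
    LinearMap.dualMap_apply, HeckeRing0.toEnd_T, HeckeRing0.toEnd_T, heckeT_degeneracyMap0_of_not_dvd h3 hq hq3']

/-- **`π^* T_q = T_q π^*` on `Λ` for every prime `q ≠ 3`** (`U_q` for `q ∣ N/3` included): transpose of
`heckeT_adjDegeneracyMap0_of_sq_dvd` (the sibling's `transferInt_smul_T` is the case `q ∤ N`).
[cite: DiamondShurman2005, Prop. 5.2.2(a) (q-expansions of T_q, U_q; derived reading, coefficientwise)] -/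
theorem transferInt_smul_T_of_ne_three {q : ℕ} (hq : q.Prime) (hq3 : q ≠ 3) (y : periodHomologyHecke (N / 3)) :
    transferInt N h9 (HeckeRing0.T (N / 3) 2 q hq • y) = HeckeRing0.T N 2 q hq • transferInt N h9 y := by
  haveI : NeZero q := ⟨hq.ne_zero⟩
  apply Subtype.ext
  refine LinearMap.ext fun f ↦ ?_
  rw [coe_transferInt, LinearMap.dualMap_apply, coe_smul_apply, coe_smul_apply, coe_transferInt,
    LinearMap.dualMap_apply, HeckeRing0.toEnd_T, HeckeRing0.toEnd_T, heckeT_adjDegeneracyMap0_of_sq_dvd Nat.prime_three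
      h9 hq hq3]

/-- **`π_* x = π_* x' ↔ Nm x = Nm x'`** (`Nm = π^* π_*` with `π^*` injective). [cite: LangeRodriguez2022, Prop. 3.5.1 (PDF p. 67)] -/
theorem pushforwardInt_eq_pushforwardInt_iff (x x' : periodHomologyHecke N) :
    pushforwardInt N h3 x = pushforwardInt N h3 x' ↔ normInt N h9 x = normInt N h9 x' := by
  rw [← transferInt_pushforwardInt N h9 x, ← transferInt_pushforwardInt N h9 x']
  exact ⟨fun h ↦ by rw [h], fun h ↦ transferInt_injective N h9 h⟩

/-- **`ker π_* = Λ_P`**: the kernel of `π_* : H₁(X₀(N), ℤ) → H₁(X₀(N/3), ℤ)` is the Prym lattice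
`ker(1 + t + t²) = prymLattice N h9` (Lange–Rodríguez: the Prym variety of `f` is the complement of `f^*J(Y)`,
`ker Nm_f`). [cite: LangeRodriguez2022, Prop. 3.5.1 (PDF p. 67)] -/
theorem ker_pushforwardInt_eq_prymLattice : LinearMap.ker (pushforwardInt N h3) = prymLattice N h9 := by
  ext x
  rw [LinearMap.mem_ker, mem_prymLattice_iff, ← (pushforwardInt N h3).map_zero,
    pushforwardInt_eq_pushforwardInt_iff N h9 h3, map_zero]

/-- `π_* x = 0 ↔ Nm x = 0`. [cite: LangeRodriguez2022, Prop. 3.5.1 (PDF p. 67)] -/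
theorem pushforwardInt_eq_zero_iff (x : periodHomologyHecke N) :
    pushforwardInt N h3 x = 0 ↔ normInt N h9 x = 0 := by
  rw [← LinearMap.mem_ker, ker_pushforwardInt_eq_prymLattice N h9 h3, mem_prymLattice_iff]

include h9 in
/-- **`3 Λ_{N/3} ⊆ π_* Λ_N`** (`3y = π_*(π^* y)`): `π_* Λ_N` is a sublattice of `3`-power index of
`H₁(X₀(N/3), ℤ)`. [cite: LangeRodriguez2022, §3.2.1 (PDF p. 55)] -/
theorem three_smul_mem_range_pushforwardInt (y : periodHomologyHecke (N / 3)) :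
    3 • y ∈ LinearMap.range (pushforwardInt N h3) :=
  ⟨transferInt N h9 y, pushforwardInt_transferInt N h9 y⟩

/-- **`Nm Λ_N = π^*(π_* Λ_N)`** as submodules. [cite: LangeRodriguez2022, Prop. 3.5.1 (PDF p. 67)] -/
theorem range_normInt_eq_map_transferInt :
    LinearMap.range (normInt N h9) = Submodule.map (transferInt N h9) (LinearMap.range (pushforwardInt N h3)) := by
  rw [LinearMap.range_eq_map, LinearMap.range_eq_map, ← Submodule.map_comp,
    ← normInt_eq_transferInt_comp_pushforwardInt N h9]

end Lattice

/-! ### §3. Transport of «no `ā`-generalised eigenvector mod `3`» from `Λ_{N/3}` to the norm image of `Λ_N` -/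

section Transport

variable (N : ℕ) [NeZero N]

/-- `(T − a)^k • x`, the power taken in `𝕋_ℤ`, is `(T̂ − a)^k x` for the `ℤ`-linear operator `T̂ = heckeInt N T`
(private plumbing: `heckeInt` is a ring homomorphism). [folklore] -/
private theorem sub_intCast_pow_smul_eq (T : HeckeRing0 N 2) (a : ℤ) (k : ℕ) (x : periodHomologyHecke N) :
    (T - (a : HeckeRing0 N 2)) ^ k • x =
      ((heckeInt N T - a • (1 : Module.End ℤ (periodHomologyHecke N))) ^ k) x := by
  rw [← heckeInt_apply, map_pow, map_sub, map_intCast, zsmul_one]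

/-- The submodule `3Λ` (private plumbing). [folklore] -/
private theorem mem_range_three_smul_id_iff (x : periodHomologyHecke N) :
    x ∈ LinearMap.range ((3 : ℤ) • (LinearMap.id : periodHomologyHecke N →ₗ[ℤ] periodHomologyHecke N)) ↔
      ∃ u : periodHomologyHecke N, x = (3 : ℕ) • u := by
  simp only [LinearMap.mem_range, LinearMap.smul_apply, LinearMap.id_apply]
  constructor
  · rintro ⟨u, rfl⟩
    exact ⟨u, (natCast_zsmul u 3).symm ▸ rfl⟩
  · rintro ⟨u, rfl⟩
    exact ⟨u, natCast_zsmul u 3⟩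

/-- `Λ/3Λ` is finite: `Λ = H₁(X₀(N), ℤ)` is a finitely generated `ℤ`-module (private plumbing for the Artinian
hypothesis of the Fitting corollary). [folklore] -/
private theorem finite_quotient_range_three_smul_id :
    Finite (periodHomologyHecke N ⧸
      LinearMap.range ((3 : ℤ) • (LinearMap.id : periodHomologyHecke N →ₗ[ℤ] periodHomologyHecke N))) := by
  haveI := moduleFinite_int_periodHomologyHecke N
  haveI : Module.Finite ℤ (periodHomologyHecke N ⧸
      LinearMap.range ((3 : ℤ) • (LinearMap.id : periodHomologyHecke N →ₗ[ℤ] periodHomologyHecke N))) :=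
    Module.Finite.quotient ℤ _
  refine Module.finite_of_fg_torsion _ fun x ↦ ⟨⟨3, mem_nonZeroDivisors_of_ne_zero (by norm_num)⟩, ?_⟩
  obtain ⟨x, rfl⟩ := Submodule.Quotient.mk_surjective _ x
  exact (Submodule.Quotient.mk_eq_zero _).mpr ⟨x, rfl⟩

variable [NeZero (N / 3)] (h9 : 3 ^ 2 ∣ N) (h3 : 3 ∣ N)

/-- `π_*` intertwines the operators `(T_p − a)^k` at levels `N` and `N/3` (`p ≠ 3` prime; private plumbing over
`pushforwardInt_smul_T_of_ne_three`). [folklore] -/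
private theorem pushforwardInt_pow_sub_apply {p : ℕ} (hp : p.Prime) (hp3 : p ≠ 3) (a : ℤ) (k : ℕ)
    (z : periodHomologyHecke N) :
    pushforwardInt N h3 (((heckeInt N (HeckeRing0.T N 2 p hp) - a • (1 : Module.End ℤ (periodHomologyHecke N))) ^ k) z) =
      ((heckeInt (N / 3) (HeckeRing0.T (N / 3) 2 p hp) -
        a • (1 : Module.End ℤ (periodHomologyHecke (N / 3)))) ^ k) (pushforwardInt N h3 z) := by
  induction k generalizing z with
  | zero => simp
  | succ k ih =>
    rw [pow_succ, pow_succ, Module.End.mul_apply, Module.End.mul_apply, ih]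
    congr 1
    simp only [LinearMap.sub_apply, LinearMap.smul_apply, Module.End.one_apply, heckeInt_apply, map_sub,
      map_zsmul, pushforwardInt_smul_T_of_ne_three N h3 hp hp3]

/-- **Transport of «no `ā`-generalised eigenvector mod `3`» from `H₁(X₀(N/3), ℤ)` to the norm image of
`H₁(X₀(N), ℤ)`** (`9 ∣ N`; the shape of item H1 `TprimeIrrNormImageAvoidsThree`). Let `S` be a finite set of primes and
`a : ℕ → ℤ`. Suppose that every `y ∈ Λ_{N/3}` with `(T_p − a_p)^{k_p} y ∈ 3Λ_{N/3}` for all primes `p ∈ S`, `p ≠ 3`,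
lies in `3Λ_{N/3}` — i.e. `ā = (a_p mod 3)_{p ∈ S}` is not a generalised Hecke eigensystem of the finite Hecke module
`H₁(X₀(N/3), ℤ) ⊗ 𝔽₃`. Then every `z ∈ Λ_N` with `Nm((T_p − a_p)^{k_p} z) ∈ 3Λ_N` for all such `p` has
`Nm z ∈ 3Λ_N` (`Nm = 1 + t + t² = normInt N h9`). PROOF: `K := Nm⁻¹(3Λ_N)`, `L″ := π_*(K) ⊆ Λ_{N/3}`; then
`3Λ_{N/3} ⊆ L″` (`3y = π_*π^*y`, `Nm π^* y = 3π^*y`), `L″` is `T_p`-stable (`Nm T_p = T_p Nm`, `π_* T_p = T_p π_*`,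
`p ≠ 3`), so the hypothesis (the joint `ā`-generalised eigenspace of `Λ_{N/3}/3Λ_{N/3}` is `0`) transports along
the equivariant surjection `Λ_{N/3}/3Λ_{N/3} ↠ Λ_{N/3}/L″` (`CommutingFamily.mem_of_forall_pow_sub_smul_apply_mem`:
Fitting exactness on finite modules); `π_* z` is an `ā`-generalised eigenvector mod `L″`, hence `π_* z ∈ L″ = π_*K`,
`π_* z = π_* v` with `Nm v ∈ 3Λ_N`, and `Nm z = π^*π_* z = π^*π_* v = Nm v`. (The lattice principle: `π_*Λ_N` and
`Λ_{N/3}` are `3`-isogenous Hecke lattices, so they have the same mod-`3` eigensystem support — Serre, *Linear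
Representations*, §15.2, for a commuting family instead of a group.) [cite: LangeRodriguez2022, Prop. 3.5.1 and §3.2.1 (derived reading: Nm = π^*π_*, π_*π^* = 3, combined with Fitting exactness `CommutingFamily.mem_of_forall_pow_sub_smul_apply_mem`; proof in the docstring)] -/
theorem exists_normInt_eq_three_smul_of_level_div_three (S : Finset ℕ) (a : ℕ → ℤ)
    (hM : ∀ y : periodHomologyHecke (N / 3),
      (∀ (p : ℕ) (hp : p.Prime), p ≠ 3 → p ∈ S →
        ∃ (k : ℕ) (u : periodHomologyHecke (N / 3)),
          (HeckeRing0.T (N / 3) 2 p hp - (a p : HeckeRing0 (N / 3) 2)) ^ k • y = (3 : ℕ) • u) →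
      ∃ u : periodHomologyHecke (N / 3), y = (3 : ℕ) • u)
    (z : periodHomologyHecke N)
    (hz : ∀ (p : ℕ) (hp : p.Prime), p ≠ 3 → p ∈ S →
      ∃ (k : ℕ) (u : periodHomologyHecke N),
        normInt N h9 ((HeckeRing0.T N 2 p hp - (a p : HeckeRing0 N 2)) ^ k • z) = (3 : ℕ) • u) :
    ∃ u : periodHomologyHecke N, normInt N h9 z = (3 : ℕ) • u := by
  classical
  have h3 : 3 ∣ N := (dvd_pow_self 3 two_ne_zero).trans h9
  -- notation: `3Λ_{N/3}`, `3Λ_N`, `K = Nm⁻¹(3Λ_N)`, `L″ = π_*(K)`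
  let A' : Submodule ℤ (periodHomologyHecke (N / 3)) :=
    LinearMap.range ((3 : ℤ) • (LinearMap.id : periodHomologyHecke (N / 3) →ₗ[ℤ] periodHomologyHecke (N / 3)))
  let A : Submodule ℤ (periodHomologyHecke N) :=
    LinearMap.range ((3 : ℤ) • (LinearMap.id : periodHomologyHecke N →ₗ[ℤ] periodHomologyHecke N))
  let K : Submodule ℤ (periodHomologyHecke N) := A.comap (normInt N h9)
  let B : Submodule ℤ (periodHomologyHecke (N / 3)) := K.map (pushforwardInt N h3)
  have hmemK : ∀ v : periodHomologyHecke N, v ∈ K ↔ ∃ u : periodHomologyHecke N, normInt N h9 v = (3 : ℕ) • u :=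
    fun v ↦ by rw [Submodule.mem_comap, mem_range_three_smul_id_iff]
  -- the operators: `T_p` as `ℤ`-linear endomorphisms (zero off the primes `≠ 3`, harmless)
  let s : Finset ℕ := S.filter (fun p ↦ p.Prime ∧ p ≠ 3)
  have hs : ∀ p ∈ s, p.Prime ∧ p ≠ 3 := fun p hp ↦ (Finset.mem_filter.mp hp).2
  have hsS : ∀ p ∈ s, p ∈ S := fun p hp ↦ (Finset.mem_filter.mp hp).1
  let f : ℕ → Module.End ℤ (periodHomologyHecke (N / 3)) := fun p ↦
    if hp : p.Prime then heckeInt (N / 3) (HeckeRing0.T (N / 3) 2 p hp) else 0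
  let g : ℕ → Module.End ℤ (periodHomologyHecke N) := fun p ↦
    if hp : p.Prime then heckeInt N (HeckeRing0.T N 2 p hp) else 0
  have hf : ∀ (p : ℕ) (hp : p.Prime), f p = heckeInt (N / 3) (HeckeRing0.T (N / 3) 2 p hp) :=
    fun p hp ↦ dif_pos hp
  have hg : ∀ (p : ℕ) (hp : p.Prime), g p = heckeInt N (HeckeRing0.T N 2 p hp) := fun p hp ↦ dif_pos hp
  have hc : ∀ i ∈ s, ∀ j ∈ s, Commute (f i) (f j) := fun i hi j hj ↦ by
    rw [hf i (hs i hi).1, hf j (hs j hj).1]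
    exact (Commute.all _ _).map (heckeInt (N / 3))
  -- stability of `3Λ'` and of `L″`
  have hA' : ∀ i ∈ s, A' ≤ A'.comap (f i) := fun i _ ↦ by
    rintro _ ⟨u, rfl⟩
    refine ⟨f i u, ?_⟩
    simp only [LinearMap.smul_apply, LinearMap.id_apply, map_zsmul]
  have hKst : ∀ (p : ℕ) (hp : p.Prime), p ≠ 3 → ∀ v ∈ K, g p v ∈ K := fun p hp hp3 v hv ↦ by
    rw [hmemK] at hv ⊢
    obtain ⟨u, hu⟩ := hv
    refine ⟨HeckeRing0.T N 2 p hp • u, ?_⟩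
    rw [hg p hp, heckeInt_apply, normInt_smul_T h9 hp hp3, hu]
    exact smul_comm _ _ _
  have hB : ∀ i ∈ s, B ≤ B.comap (f i) := fun i hi ↦ by
    rintro _ ⟨v, hv, rfl⟩
    refine ⟨g i v, hKst i (hs i hi).1 (hs i hi).2 v hv, ?_⟩
    rw [hf i (hs i hi).1, hg i (hs i hi).1, heckeInt_apply, heckeInt_apply,
      pushforwardInt_smul_T_of_ne_three N h3 (hs i hi).1 (hs i hi).2]
  have hA'B : A' ≤ B := by
    rintro _ ⟨y, rfl⟩
    refine Submodule.mem_map.mpr ⟨transferInt N h9 y, (hmemK _).mpr ⟨transferInt N h9 y, normInt_transferInt N h9 y⟩, ?_⟩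
    simp only [LinearMap.smul_apply, LinearMap.id_apply]
    rw [pushforwardInt_transferInt N h9 y]
    exact (natCast_zsmul y 3).symm
  -- finiteness: `Λ'/3Λ'` is finite (Artinian), `Λ'/L″` is Noetherian
  haveI : Finite (periodHomologyHecke (N / 3) ⧸ A') := finite_quotient_range_three_smul_id (N / 3)
  haveI : IsArtinian ℤ (periodHomologyHecke (N / 3) ⧸ A') := isArtinian_of_finite
  haveI : Module.Finite ℤ (periodHomologyHecke (N / 3)) := moduleFinite_int_periodHomologyHecke (N / 3)
  haveI : Module.Finite ℤ (periodHomologyHecke (N / 3) ⧸ B) := Module.Finite.quotient ℤ B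
  haveI : IsNoetherian ℤ (periodHomologyHecke (N / 3) ⧸ B) := inferInstance
  -- the hypothesis at level `N/3` in the operator form
  have hGA : ∀ y : periodHomologyHecke (N / 3),
      (∀ i ∈ s, ∃ k : ℕ, ((f i - a i • (1 : Module.End ℤ (periodHomologyHecke (N / 3)))) ^ k) y ∈ A') →
        y ∈ A' := by
    intro y hy
    rw [mem_range_three_smul_id_iff]
    refine hM y fun p hp hp3 hpS ↦ ?_
    obtain ⟨k, hk⟩ := hy p (Finset.mem_filter.mpr ⟨hpS, hp, hp3⟩)
    rw [hf p hp, mem_range_three_smul_id_iff] at hk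
    obtain ⟨u, hu⟩ := hk
    exact ⟨k, u, by rw [sub_intCast_pow_smul_eq, hu]⟩
  -- `π_* z` is an `ā`-generalised eigenvector modulo `L″`
  have hy : ∀ i ∈ s, ∃ k : ℕ,
      ((f i - a i • (1 : Module.End ℤ (periodHomologyHecke (N / 3)))) ^ k) (pushforwardInt N h3 z) ∈ B := by
    intro p hp
    obtain ⟨k, u, hu⟩ := hz p (hs p hp).1 (hs p hp).2 (hsS p hp)
    refine ⟨k, (HeckeRing0.T N 2 p (hs p hp).1 - (a p : HeckeRing0 N 2)) ^ k • z, (hmemK _).mpr ⟨u, hu⟩, ?_⟩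
    rw [sub_intCast_pow_smul_eq, pushforwardInt_pow_sub_apply N h3 (hs p hp).1 (hs p hp).2, hf p (hs p hp).1]
  -- transport
  have hzB : pushforwardInt N h3 z ∈ B :=
    Literature.LinearAlgebra.CommutingFamily.mem_of_forall_pow_sub_smul_apply_mem s f (fun p ↦ a p) hc A' B hA'B
      hA' hB hGA hy
  obtain ⟨v, hv, hvz⟩ := hzB
  obtain ⟨u, hu⟩ := (hmemK v).mp hv
  refine ⟨u, ?_⟩
  rw [← transferInt_pushforwardInt N h9 z, ← hu, ← transferInt_pushforwardInt N h9 v]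
  exact congrArg (transferInt N h9) hvz.symm

/-- The same transport with the hypothesis at level `N/3` phrased for ALL `y` as «no joint generalised
eigenvector»: contrapositive packaging `(∃ z with Nm-eigen data and Nm z ∉ 3Λ_N) → (∃ y ∈ Λ_{N/3} ∖ 3Λ_{N/3} joint
generalised eigenvector mod 3)`. [cite: LangeRodriguez2022, Prop. 3.5.1 and §3.2.1 (derived reading, see `exists_normInt_eq_three_smul_of_level_div_three`)] -/
theorem exists_genEigenvector_level_div_three_of_normInt (S : Finset ℕ) (a : ℕ → ℤ) (z : periodHomologyHecke N)
    (hz : ∀ (p : ℕ) (hp : p.Prime), p ≠ 3 → p ∈ S →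
      ∃ (k : ℕ) (u : periodHomologyHecke N),
        normInt N h9 ((HeckeRing0.T N 2 p hp - (a p : HeckeRing0 N 2)) ^ k • z) = (3 : ℕ) • u)
    (hne : ∀ u : periodHomologyHecke N, normInt N h9 z ≠ (3 : ℕ) • u) :
    ∃ y : periodHomologyHecke (N / 3),
      (∀ (p : ℕ) (hp : p.Prime), p ≠ 3 → p ∈ S →
        ∃ (k : ℕ) (u : periodHomologyHecke (N / 3)),
          (HeckeRing0.T (N / 3) 2 p hp - (a p : HeckeRing0 (N / 3) 2)) ^ k • y = (3 : ℕ) • u) ∧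
      ∀ u : periodHomologyHecke (N / 3), y ≠ (3 : ℕ) • u := by
  by_contra hcon
  push Not at hcon
  obtain ⟨u, hu⟩ := exists_normInt_eq_three_smul_of_level_div_three N h9 S a
    (fun y hy ↦ hcon y hy) z hz
  exact hne u hu

end Transport

/-! ## From a joint generalised mod-`3` eigenvector to an honest one (Hoffman–Kunze § 6.5 Lemma), and H1 -/

section EigenvectorModThree

variable (N : ℕ) [NeZero N]

/-- **A joint generalised mod-`3` Hecke eigenvector of `Λ = H₁(X₀(N), ℤ)` yields an honest joint mod-`3`
eigenvector.** If `y ∈ Λ ∖ 3Λ` has `(T_p − a_p)^{k_p} y ∈ 3Λ` for all primes `p ≠ 3` in `S`, then some `w ∈ Λ ∖ 3Λ`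
has `(T_p − a_p) w ∈ 3Λ` for all those `p` — the tree's `CommutingFamily.exists_joint_eigenvector_mod`
(Hoffman–Kunze § 6.5, Lemma before Theorem 7: a commuting family with a common invariant subspace `W` has a vector
`α ∉ W` with every `(T − c_T)α ∈ W`) for the commuting `ℤ`-linear operators `T̂_p = heckeInt N (T_p)` and `W = 3Λ`.
This reduces the «no `ā`-generalised eigenvector mod 3» statements of this file (the shape of the TQMP items H1/L31)
to honest mod-`3` eigenvectors, the input of the Deligne–Serre lifting lemma
(`Literature.Algebra.Module.DeligneSerreLifting.deligneSerre_lifting_eigenvector`, with `𝒪 = ℤ`, `𝔪 = (3)`).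
[cite: HoffmanKunze1971LinearAlgebra, §6.5 Lemma before Thm. 7 (p. 207)] -/
theorem exists_eigenvector_mod_three_of_genEigenvector (S : Finset ℕ) (a : ℕ → ℤ) (y : periodHomologyHecke N)
    (hy : ∀ (p : ℕ) (hp : p.Prime), p ≠ 3 → p ∈ S →
      ∃ (k : ℕ) (u : periodHomologyHecke N),
        (HeckeRing0.T N 2 p hp - (a p : HeckeRing0 N 2)) ^ k • y = (3 : ℕ) • u)
    (hne : ∀ u : periodHomologyHecke N, y ≠ (3 : ℕ) • u) :
    ∃ w : periodHomologyHecke N, (∀ u : periodHomologyHecke N, w ≠ (3 : ℕ) • u) ∧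
      ∀ (p : ℕ) (hp : p.Prime), p ≠ 3 → p ∈ S →
        ∃ u : periodHomologyHecke N, (HeckeRing0.T N 2 p hp - (a p : HeckeRing0 N 2)) • w = (3 : ℕ) • u := by
  classical
  let A : Submodule ℤ (periodHomologyHecke N) :=
    LinearMap.range ((3 : ℤ) • (LinearMap.id : periodHomologyHecke N →ₗ[ℤ] periodHomologyHecke N))
  let s : Finset ℕ := S.filter (fun p ↦ p.Prime ∧ p ≠ 3)
  have hs : ∀ p ∈ s, p.Prime ∧ p ≠ 3 := fun p hp ↦ (Finset.mem_filter.mp hp).2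
  have hsS : ∀ p ∈ s, p ∈ S := fun p hp ↦ (Finset.mem_filter.mp hp).1
  let f : ℕ → Module.End ℤ (periodHomologyHecke N) := fun p ↦
    if hp : p.Prime then heckeInt N (HeckeRing0.T N 2 p hp) else 0
  have hf : ∀ (p : ℕ) (hp : p.Prime), f p = heckeInt N (HeckeRing0.T N 2 p hp) := fun p hp ↦ dif_pos hp
  have hc : ∀ i ∈ s, ∀ j ∈ s, Commute (f i) (f j) := fun i hi j hj ↦ by
    rw [hf i (hs i hi).1, hf j (hs j hj).1]
    exact (Commute.all _ _).map (heckeInt N)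
  have hA : ∀ i ∈ s, A ≤ A.comap (f i) := fun i _ ↦ by
    rintro _ ⟨u, rfl⟩
    refine ⟨f i u, ?_⟩
    simp only [LinearMap.smul_apply, LinearMap.id_apply, map_zsmul]
  have hyA : y ∉ A := fun h ↦ by
    obtain ⟨u, hu⟩ := (mem_range_three_smul_id_iff N y).mp h
    exact hne u hu
  have hgen : ∀ i ∈ s, ∃ k : ℕ,
      ((f i - a i • (1 : Module.End ℤ (periodHomologyHecke N))) ^ k) y ∈ A := fun p hp ↦ by
    obtain ⟨k, u, hu⟩ := hy p (hs p hp).1 (hs p hp).2 (hsS p hp)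
    refine ⟨k, (mem_range_three_smul_id_iff N _).mpr ⟨u, ?_⟩⟩
    rw [hf p (hs p hp).1, ← sub_intCast_pow_smul_eq, hu]
  obtain ⟨w, hwA, hw⟩ :=
    Literature.LinearAlgebra.CommutingFamily.exists_joint_eigenvector_mod s f (fun p ↦ a p) hc A hA hyA hgen
  refine ⟨w, fun u hu ↦ hwA ((mem_range_three_smul_id_iff N w).mpr ⟨u, hu⟩), fun p hp hp3 hpS ↦ ?_⟩
  have h := hw p (Finset.mem_filter.mpr ⟨hpS, hp, hp3⟩)
  rw [hf p hp, mem_range_three_smul_id_iff] at h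
  obtain ⟨u, hu⟩ := h
  refine ⟨u, ?_⟩
  rw [← hu, ← pow_one (HeckeRing0.T N 2 p hp - (a p : HeckeRing0 N 2)), sub_intCast_pow_smul_eq, pow_one,
    LinearMap.sub_apply, LinearMap.smul_apply, Module.End.one_apply]

variable [NeZero (N / 3)] (h9 : 3 ^ 2 ∣ N)

/-- **An honest mod-`3` Hecke eigenvector at level `N/3` from a failure of the H1-shape at level `N`** (`9 ∣ N`):
if `z ∈ Λ_N` has `Nm((T_p − a_p)^{k_p} z) ∈ 3Λ_N` for all primes `p ≠ 3` in `S` but `Nm z ∉ 3Λ_N`, then some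
`w ∈ Λ_{N/3} ∖ 3Λ_{N/3}` satisfies `(T_p − a_p) w ∈ 3Λ_{N/3}` for all those `p` — i.e. the system
`(a_p mod 3)_{p ∈ S, p ≠ 3}` OCCURS as a joint eigen-system in `H₁(X₀(N/3), ℤ) ⊗ 𝔽₃`
(`exists_genEigenvector_level_div_three_of_normInt` + `exists_eigenvector_mod_three_of_genEigenvector`); this is the
form in which the Deligne–Serre lifting lemma and a Serre-weight exclusion at level `N/3` refute it.
[cite: HoffmanKunze1971LinearAlgebra, §6.5 Lemma before Thm. 7 (p. 207)] [cite: LangeRodriguez2022, Prop. 3.5.1 and §3.2.1 (derived reading, see `exists_normInt_eq_three_smul_of_level_div_three`)] -/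
theorem exists_eigenvector_mod_three_level_div_three_of_normInt (S : Finset ℕ) (a : ℕ → ℤ)
    (z : periodHomologyHecke N)
    (hz : ∀ (p : ℕ) (hp : p.Prime), p ≠ 3 → p ∈ S →
      ∃ (k : ℕ) (u : periodHomologyHecke N),
        normInt N h9 ((HeckeRing0.T N 2 p hp - (a p : HeckeRing0 N 2)) ^ k • z) = (3 : ℕ) • u)
    (hne : ∀ u : periodHomologyHecke N, normInt N h9 z ≠ (3 : ℕ) • u) :
    ∃ w : periodHomologyHecke (N / 3), (∀ u : periodHomologyHecke (N / 3), w ≠ (3 : ℕ) • u) ∧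
      ∀ (p : ℕ) (hp : p.Prime), p ≠ 3 → p ∈ S →
        ∃ u : periodHomologyHecke (N / 3),
          (HeckeRing0.T (N / 3) 2 p hp - (a p : HeckeRing0 (N / 3) 2)) • w = (3 : ℕ) • u := by
  obtain ⟨y, hy, hyne⟩ := exists_genEigenvector_level_div_three_of_normInt N h9 S a z hz hne
  exact exists_eigenvector_mod_three_of_genEigenvector (N / 3) S a y hy hyne

end EigenvectorModThree

end Literature.NumberTheory.ModularSymbols
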